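import Summits.BirchSwinnertonDyer.BirchSwinnertonDyer.Theorems.CMKolyvaginAtInertTwoSilentSupplyOfPrimeTwistSupply
import Summits.BirchSwinnertonDyer.BirchSwinnertonDyer.Theorems.CMKolyvaginAtInertTwoCMPrimitiveSupplyAtInertTwoOfKolyvaginConjecture
import Literature.NumberTheory.EllipticCurves.BSDSelmerCMPConverse
import Literature.NumberTheory.EllipticCurves.AnalyticRankOrderProofs
import HarnessLib

/-!
# Route `CMKolyvaginAtInertTwo`, crux HL′ `CMSilentHeegnerTwinSupplyAtInertTwo` (stmt-BirchSwinnertonDyer-28663) —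
# HL′ IS AN ALGEBRAIC STATEMENT MODULO PRINT: Burungale–Tian's rank-zero `p`-converse (Ann. of Math. 203 (2026), Thm. 1.1,
# ANY prime `p`, any CM curve over `ℚ`) turns «some prime twist `W^{(−q)}`, `4N_W ∣ q + 1`, has `corank_{ℤ_ℓ} Sel_{ℓ^∞} = 0`
# for some prime `ℓ`» into HL‴, hence HL′

Seat `bsd-line-cmk2-p1` g23 (cell `bsd-print-cf2`), `--supports stmt-BirchSwinnertonDyer-28663` (helper; closes nothing).
THEOREMS ONLY (no definition, no named fact, no `sorry`).  BSD is NOT proved by this; HL′ is NOT proved by this.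

So far every road to HL′ in the cell's census was ANALYTIC (pen memo `HLPRIME-ATTACK-MEMO-g23` §8: E1 Kriz–Li + class numbers,
E2 first moment over primes — only under GRH even at level 1 (Gao–Zhao 2022), E3 ternary theta).  The tree fact
`burungaleTian_analyticRank_eq_zero_of_selmerCorank_eq_zero_of_hasCM` (Burungale–Tian 2026, Thm. 1.1: for a CM curve `E/ℚ` and
ANY prime `ℓ`, `corank_{ℤ_ℓ} Sel_{ℓ^∞}(E/ℚ) = 0 ⟹ ord_{s=1} L(E, s) = 0` — uniform in `ℓ`, in particular `ℓ = 2` and CM field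
`ℚ(√−3)`, exactly the habitat's case that Rubin 1991 excludes) opens an ALGEBRAIC road: the twist `W^{(−q)}` of a CM curve is CM,
so a Selmer-corank-zero certificate at any prime `ℓ` gives `L(W^{(−q)}, 1) ≠ 0`, i.e. the pen's HL‴, and g22's
`KolyvaginLowerTwo.exists_silentHeegnerField_of_prime_twist` turns HL‴ into the HL′ field `ℚ(√−q)` (odd, `≠ −3`, Heegner, `Σ = 1`).

* `entireLFunction_twist_ne_zero_of_selmerCorank_eq_zero` — per curve and twist: `W` CM, `d ≠ 0`, `corank_ℓ Sel_{ℓ^∞}(W^{(d)}) = 0`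
  ⟹ `L(W^{(d)}, 1) ≠ 0` (Burungale–Tian + modularity).
* `exists_silentHeegnerField_of_selmerCorank_eq_zero` — per curve: `W ∈ H₂^{HL}` (CM, `2` inert, `ρ̄₂` onto), a prime `q` with
  `4N_W ∣ q + 1` and a prime `ℓ` with `corank_ℓ Sel_{ℓ^∞}(W^{(−q)}) = 0` ⟹ the conclusion of HL′ for `W`.
* **`cmSilentHeegnerTwinSupply_of_burungaleTian_of_selmerSupply`** — AlgHL‴ ∧ Burungale–Tian ∧ modularity ⟹
  `CMSilentHeegnerTwinSupplyAtInertTwo` (28663) BY NAME, where **AlgHL‴** := «for every `W ∈ H₂^{HL}` (CM, `2` inert in `F`,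
  `ρ̄_{E,2}` onto, `r_an = 1`) some prime `q` with `4N_W ∣ q + 1` and some prime `ℓ` have `corank_{ℤ_ℓ} Sel_{ℓ^∞}(W^{(−q)}/ℚ) = 0`».

WHY THIS MATTERS (for the planner; nothing below is proved here).  AlgHL‴ is equivalent to HL‴ modulo print (⟸: GZK
`rank_eq_analyticRank_of_analyticRank_le_one` + finiteness of Ш), but it is a statement about SELMER CORANKS in the one-bit prime
twist family, open to algebraic attack: at `ℓ = 2`, when `Ш(W/ℚ)[2] = 0` (so `dim Sel₂(W) = 1`, `rank W = 1`, `W(ℚ)[2] = 0`),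
Mazur–Rubin's one-prime twisting (Invent. Math. 181 (2010), §3: twisting at a prime `q` with `dim W(ℚ_q)[2] = 1` at which the
localisation of `Sel₂(W)` is onto lowers the Selmer rank by one, the other local conditions being unchanged for `−q ≡ 1 (mod 8N_W)`)
together with Čebotarev in `ℚ(W[2], ½P₀)/ℚ` (group `S₄`; the class of `4`-cycles maps to the transposition class of
`Gal(ℚ(W[2])/ℚ) ≅ S₃`, i.e. to `F`-inert `q`, compatible with `q ≡ −1 (mod 8N_W)`) gives a prime `q ≡ −1 (mod 8N_W)` with
`Sel₂(W^{(−q)}) = 0`, hence corank `0`: AlgHL‴ HOLDS on `H₂ ∩ {Ш(W/ℚ)[2] = 0}` by classical algebra (not yet in the tree; L-sized).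
On `{Ш(W/ℚ)[2] ≠ 0}` one prime cannot empty `Sel₂` and a corank-zero certificate needs second-descent control (Smith-type) or
`ℓ = 3` via the rational `3`-isogeny (class-number conditions) — the residual analytic/algebraic crux.

References: [BurungaleTian2026] Thm. 1.1; [MazurRubin2010] §3; [GrossLMS1991] §2; [BCDTJAMS2001] Thm. A.
-/

set_option autoImplicit false
-- the Theorems namespace of this sub repeats the summit name by design (D-0017 nested layout)
set_option linter.dupNamespace false

noncomputable section

open scoped Classical

open WeierstrassCurve NumberField Literature.NumberTheory.EllipticCurves
  Literature.NumberTheory.EllipticCurves.Rank1Residual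
open Summit.BirchSwinnertonDyer.BirchSwinnertonDyer.Theses.CMKolyvaginAtInertTwo (CMSilentHeegnerTwinSupplyAtInertTwo)

namespace Summit.BirchSwinnertonDyer.BirchSwinnertonDyer.Theorems.KolyvaginLowerTwo

/-- **Burungale–Tian at a quadratic twist of a CM curve**: for `W/ℚ` with CM, `d ≠ 0`, and a prime `ℓ` with
`corank_{ℤ_ℓ} Sel_{ℓ^∞}(W^{(d)}/ℚ) = 0`, one has `L(W^{(d)}, 1) ≠ 0` — the twist is CM (same `j`), Burungale–Tian 2026 Thm. 1.1 gives
`r_an(W^{(d)}) = 0`, and modularity converts this to the non-vanishing of the value. Conditional on the two prints.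
[cite: BurungaleTian2026, Thm. 1.1] [cite: BCDTJAMS2001, Thm. A] [cite: SilvermanAEC2009, X.5 Cor. 5.4 (j of a twist)] -/
theorem entireLFunction_twist_ne_zero_of_selmerCorank_eq_zero
    (hBT : burungaleTian_analyticRank_eq_zero_of_selmerCorank_eq_zero_of_hasCM) (hmod : hasEntireLFunction_rat)
    (W : WeierstrassCurve ℚ) [W.IsElliptic] (hCM : W.HasCM) {d : ℚ} (hd : d ≠ 0)
    {ℓ : ℕ} (hℓ : ℓ.Prime) (h0 : (W.quadraticTwist d).selmerCorank ℓ = 0) :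
    (W.quadraticTwist d).entireLFunction 1 ≠ 0 := by
  haveI := W.isElliptic_quadraticTwist hd
  haveI : Fact ℓ.Prime := ⟨hℓ⟩
  have hCMd : (W.quadraticTwist d).HasCM := (hasCM_iff_of_j_eq (W.j_quadraticTwist hd)).mpr hCM
  have hr0 : (W.quadraticTwist d).analyticRank = 0 := hBT (W.quadraticTwist d) hCMd ℓ h0
  exact ((W.quadraticTwist d).analyticRank_eq_zero_iff_holds (hmod _)).mp hr0

/-- **Per curve: a Selmer-corank-zero prime twist in the class `q ≡ −1 (mod 4N_W)` gives the HL′ field.**  `W/ℚ` globally minimal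
with CM, `2` inert in the CM field, `ρ̄_{E,2}` onto; `q` prime with `4N_W ∣ q + 1`; `ℓ` a prime with
`corank_{ℤ_ℓ} Sel_{ℓ^∞}(W^{(−q)}/ℚ) = 0`.  Then (Burungale–Tian + modularity) `L(W^{(−q)},1) ≠ 0`, and (g22's universal frame)
`K = ℚ(√−q)` is imaginary quadratic with odd `d_K ≠ −3`, Heegner for `N_W`, one-bit genus defect, and `L(W^{(d_K)},1) ≠ 0`.
[cite: BurungaleTian2026, Thm. 1.1] [cite: GrossLMS1991, §2 (Heegner hypothesis)] -/
theorem exists_silentHeegnerField_of_selmerCorank_eq_zero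
    (hBT : burungaleTian_analyticRank_eq_zero_of_selmerCorank_eq_zero_of_hasCM) (hmod : hasEntireLFunction_rat)
    (W : WeierstrassCurve ℚ) [W.IsElliptic] [W.IsGloballyMinimal] [NeZero (W.conductorNorm ℤ)]
    (hCM : W.HasCM) (hin : Rank1Residual.CMInert W 2) (hρ2 : W.HasSurjectiveModNGaloisRep 2)
    {q : ℕ} (hq : q.Prime) (hdvd : (4 * W.conductorNorm ℤ : ℕ) ∣ q + 1)
    {ℓ : ℕ} (hℓ : ℓ.Prime) (h0 : (W.quadraticTwist (-(q : ℚ))).selmerCorank ℓ = 0) :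
    ∃ (K : Type) (_ : Field K) (_ : NumberField K), IsImaginaryQuadratic K ∧ Odd (NumberField.discr K) ∧
      NumberField.discr K ≠ -3 ∧ SatisfiesHeegnerHypothesis (W.conductorNorm ℤ) K ∧
      (∑ q ∈ (NumberField.discr K).natAbs.primeFactors,
        ((if jacobiSym W.Δ.num q = -1 then 1 else 0) + (if jacobiSym W.Δ.num q = 1 ∧ Even (W.frobeniusTrace q) then 2 else 0)) ≤ 1) ∧
      (W.quadraticTwist (NumberField.discr K : ℚ)).entireLFunction 1 ≠ 0 := by
  have hq0 : (-(q : ℚ)) ≠ 0 := by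
    have : (q : ℚ) ≠ 0 := by exact_mod_cast hq.ne_zero
    exact neg_ne_zero.mpr this
  exact exists_silentHeegnerField_of_prime_twist W hCM hin hρ2 hq hdvd
    (entireLFunction_twist_ne_zero_of_selmerCorank_eq_zero hBT hmod W hCM hq0 hℓ h0)

/-- **AlgHL‴ ∧ Burungale–Tian ∧ modularity ⟹ HL′ (`CMSilentHeegnerTwinSupplyAtInertTwo`, stmt-28663) BY NAME.**  The hypothesis
`hAlg` is the ALGEBRAIC form of the pen's HL‴: for every `W ∈ H₂^{HL}` (globally minimal, CM, `2` inert in the CM field, `ρ̄_{E,2}`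
onto, `r_an = 1`) some prime `q` with `4N_W ∣ q + 1` and some prime `ℓ` have `corank_{ℤ_ℓ} Sel_{ℓ^∞}(W^{(−q)}/ℚ) = 0`.  Modulo the two
prints this is equivalent to HL‴ (the converse direction is GZK), but it is attackable by Selmer-group algebra: on `{Ш(W/ℚ)[2] = 0}`
it follows at `ℓ = 2` from Mazur–Rubin one-prime twisting and Čebotarev (module docstring; not proved here).  HL′/HL‴/AlgHL‴ are
NOT proved by this file. [cite: BurungaleTian2026, Thm. 1.1] [cite: MazurRubin2010, §3 (shape of the supply; nothing asserted)]
[cite: GrossLMS1991, §2] -/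
theorem cmSilentHeegnerTwinSupply_of_burungaleTian_of_selmerSupply
    (hBT : burungaleTian_analyticRank_eq_zero_of_selmerCorank_eq_zero_of_hasCM) (hmod : hasEntireLFunction_rat)
    (hAlg : ∀ (W : WeierstrassCurve ℚ) [W.IsElliptic] [W.IsGloballyMinimal] [NeZero (W.conductorNorm ℤ)],
      W.HasCM → Rank1Residual.CMInert W 2 → W.HasSurjectiveModNGaloisRep (2 : ℤ) → W.analyticRank = 1 →
      ∃ q : ℕ, q.Prime ∧ (4 * W.conductorNorm ℤ : ℕ) ∣ q + 1 ∧
        ∃ ℓ : ℕ, ℓ.Prime ∧ (W.quadraticTwist (-(q : ℚ))).selmerCorank ℓ = 0) :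
    CMSilentHeegnerTwinSupplyAtInertTwo := by
  intro W _ _ _ hCM hin hρ hr
  obtain ⟨q, hq, hdvd, ℓ, hℓ, h0⟩ := hAlg W hCM hin hρ hr
  exact exists_silentHeegnerField_of_selmerCorank_eq_zero hBT hmod W hCM hin hρ hq hdvd hℓ h0

end Summit.BirchSwinnertonDyer.BirchSwinnertonDyer.Theorems.KolyvaginLowerTwo

end
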